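import Literature.AlgebraicGeometry.Resolution.HironakaDirectrixPolar
import Literature.AlgebraicGeometry.Resolution.HironakaDirectrixLemmas
import Literature.AlgebraicGeometry.Resolution.HironakaDirectrixVars
import Literature.AlgebraicGeometry.Resolution.WeightedCentreHasseDirectrixBridge
import Summits.ResolutionOfSingularities.ResolutionOfSingularities.Theorems.MarkedTransferCampaignW46TameDirectrix
import Mathlib.Algebra.MvPolynomial.PDeriv
import Mathlib.Algebra.Polynomial.Derivative
import HarnessLib

/-!
# [OURS · L1 W4.6, rung (iv) «large characteristic»] The tame directrix is first-order: for `deg F < p`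
# Hironaka's invariance space of `F` is the kernel of the polar map, `τ(F) = dim ⟨∂F/∂Y_i⟩`, and the
# threshold `deg F < p` is sharp
# (cell res-hironaka, LADDER-RESOLUTION rung L, D-0089; slot W4.6, seat res-L1-s46-pv-7; host route MarkedTransfer,
# `--supports stmt-ResolutionOfSingularities-16155 --as helper`)

HONEST FRAMING. Nothing here is a statement of H. Hironaka's manuscript (2017-03-23, [Hironaka2017]) and nothing here
asserts that any statement of it holds. This is self-contained commutative algebra over the TREE's directrix vocabulary
(`Literature.AlgebraicGeometry.Resolution.translate` / `invarianceSpace` / `directrix` / `hironakaTau`, Cossart–Piltant's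
rendering of Hironaka's intrinsic directrix; `WeightedBlowup.HasseDir.dirShift` / `hasseD`, the directional Hasse–Schmidt
derivatives) and Mathlib; no premise of the manuscript, no FACT-LIST premise. AI review is weaker than expert review.
No `sorry`; axioms standard.

## What «the honest `C` of regime (iv)» is at the tangent cone, and what this file proves about it

RESCUE-SEED §1 row W4.6 (iv) asks for the explicit threshold `C` above which the typed procedure is «char-0-like», to be
read off the barrier `Literature.Barriers.ResolutionOfSingularities.DirectrixSmallCharacteristic*` (CJS Thm. 3.14 needs
`char κ(x) = 0` or `≥ dim X/2 + 1`) and the prior's V5 («wild data reappear at level 1 via `b!`»). Two different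
phenomena hide behind these:

* the NEAR-POINT confinement of CJS Thm. 3.14 fails only at points with IMPERFECT residue field (the barrier's own
  «Narrowing» section: Hironaka's quadric needs `[k : k²] ≥ 4`; over a perfect field the obstruction is empty), so over
  a perfect ground field it is not the binding constraint of regime (iv);
* the DERIVATIVE CALCULUS of the directrix — computing Hironaka's invariance space `𝕎(F) = {w | F(Y + Tw) = F(Y)}`
  and `τ(F) = d − dim 𝕎(F)` from partial derivatives — is valid exactly in the TAME degrees `deg F < p`.

This file proves the second point as an EQUALITY with a SHARP threshold, closing the gap recorded in the tree
(`HironakaDirectrixPolar`, module docstring: «with equality when `char k = 0` or `char k > deg F`, not proved here»):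

* `derivative_dirShift` — the chain rule `d/dT F(x + Tv) = (∂_v F)(x + Tv)` for the directional shift, over any
  commutative ring; hence `hasseD_polar`: `D_v^{(j)}(∂_v F) = (j + 1) · D_v^{(j+1)} F`.
* `hasseD_eq_zero_of_polar_eq_zero` — if `∂_v F := Σ_i v_i ∂F/∂Y_i = 0` and `1, …, deg F` are non-zero in the field,
  then EVERY positive-order directional Hasse derivative of `F` along `v` vanishes.
* `invarianceSpace_singleton_eq_ker_polar` — THE TAME DIRECTRIX IS FIRST-ORDER: `𝕎({F}) = ker (w ↦ ∂_w F)`;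
  `hironakaTau_singleton_eq_finrank_span_pderiv` — `τ({F}) = dim_k ⟨∂F/∂Y_1, …, ∂F/∂Y_d⟩` (equality in the tree's
  `finrank_span_pderiv_le_hironakaTau`); `invarianceSpace_eq_iInf_ker_polar` — the same for a set of polynomials;
  corollaries `…_of_totalDegree_lt_char` (characteristic `p > deg F`) and `…_of_charZero`.
* `mem_invarianceSpace_singleton_iff_top_polars` — equivalently (Giraud's lemma in the tame case, cf.
  Berthomieu–Hivert–Mourtada, Lemma 3.6 with Cor. 2.3 and Algorithm 3.5: the ridge is generated by the Hasse
  derivatives of `p`-power degree, in characteristic `0` by the linear ones): for a FORM of degree `b` with `1, …, b`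
  non-zero in `k`, `𝕎({F})` is the common zero set of the linear forms `∂^A F`, `|A| = b − 1` — the directrix is cut
  out by the `(b−1)`-st partials (uses the seat's `TameDirectrix.dirDeriv_eq_zero_of_partials`, p477862).
* SHARPNESS at `deg F = p`: for `F = Y_0^p` in characteristic `p` every partial vanishes (`pderiv_X_zero_pow_char`), so
  the polar kernel is everything and the polar rank is `0` (`finrank_span_pderiv_X_pow_char`), yet `e_0 ∉ 𝕎({F})`
  (`single_notMem_invarianceSpace_X_pow_char`) and `τ(Y_0^p) = 1` (`hironakaTau_X_pow_char`): the equality fails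
  (`invarianceSpace_X_pow_char_ne_ker_polar`).

So for the directrix step of regime (iv) the honest constant is `C = b`, the degree of the tangent form (`≤ d`, the
degree bound of the input), INDEPENDENT of the dimension `n`: «`p > C(n, d)` with `C(n, d) = d`» makes every tangent-cone
directrix computation of the first stage characteristic-zero-like, and no smaller uniform constant does. (What happens at
deeper levels — V5's `b!` for coefficient ideals — is not addressed here.)

## References (context; nothing is cited as a premise)

* Tree: `HironakaDirectrix`, `HironakaDirectrixPolar` (polar lower bound), `WeightedCentreHasseSubspace` /
  `WeightedCentreHasseDirectrixBridge` (`𝕎(S)` through Hasse derivatives), this seat's `MarkedTransferCampaignW46TameDirectrix`.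
* J. Berthomieu, P. Hivert, H. Mourtada, *Computing Hironaka's invariants: ridge and directrix*, Contemp. Math. 521
  (2010): Def. 1.1/1.2, Cor. 2.3 (Giraud), Lemma 3.6, Algorithm 3.5 (lit key `paper:galaxy-pdf-1186687500`, p. 11).
  [cite: BerthomieuHivertMourtada2010, Cor. 2.3, Lemma 3.6, Algorithm 3.5]
* H. Hironaka, *Additive groups associated with points of a projective space*, Ann. of Math. 92 (1970) §1–2.
  [cite: Hironaka1970AdditiveGroups, §1–2]
* Barrier `Literature.Barriers.ResolutionOfSingularities.DirectrixSmallCharacteristic` (module docstring, «Narrowing»).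
-/

noncomputable section

set_option linter.dupNamespace false -- mandated namespace of this single-conjunct summit

namespace Summit.ResolutionOfSingularities.ResolutionOfSingularities.Theorems
namespace CampaignW46
namespace TamePolar

open MvPolynomial
open Literature.AlgebraicGeometry.Resolution
open Literature.AlgebraicGeometry.Resolution.WeightedBlowup.HasseDir

open scoped BigOperators

/-! ## The chain rule for the directional shift `H ↦ H(x + Tv)` (any commutative ring) -/

section ChainRule

variable {σ : Type*} [Fintype σ] {R : Type*} [CommRing R]

/-- **Chain rule** `d/dT H(x + Tv) = (Σ_i v_i ∂_i H)(x + Tv)`: the `T`-derivative of the directional shift is the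
directional shift of the polar `∂_v H`. [folklore] -/
theorem derivative_dirShift (v : σ → R) (H : MvPolynomial σ R) :
    Polynomial.derivative (dirShift v H) = dirShift v (∑ i, C (v i) * pderiv i H) := by
  classical
  induction H using MvPolynomial.induction_on with
  | C a =>
    simp only [dirShift_C, Polynomial.derivative_C, pderiv_C, mul_zero, Finset.sum_const_zero, map_zero]
  | add p q hp hq =>
    simp only [map_add, hp, hq, mul_add, Finset.sum_add_distrib]
  | mul_X p i hp =>
    have hδ : ∀ j : σ, pderiv j (X i : MvPolynomial σ R) = if j = i then 1 else 0 := fun j => by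
      rw [pderiv_X]; simp [Pi.single_apply, eq_comm]
    have hsum : (∑ j, C (v j) * pderiv j (p * X i)) = (∑ j, C (v j) * pderiv j p) * X i + C (v i) * p := by
      simp only [pderiv_mul, hδ, mul_add, mul_ite, mul_one, mul_zero, Finset.sum_add_distrib,
        Finset.sum_ite_eq', Finset.mem_univ, if_true, Finset.sum_mul]
      congr 1
      exact Finset.sum_congr rfl fun j _ => by ring
    rw [hsum]
    simp only [map_add, map_mul, dirShift_X, dirShift_C, Polynomial.derivative_mul, Polynomial.derivative_C,
      Polynomial.derivative_X, mul_one, hp]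
    ring

/-- **Hasse derivatives of the polar**: `D_v^{(j)} (∂_v H) = (j + 1) · D_v^{(j+1)} H` (take the coefficient of `T^j`
in the chain rule). [folklore] -/
theorem hasseD_polar (v : σ → R) (j : ℕ) (H : MvPolynomial σ R) :
    hasseD v j (∑ i, C (v i) * pderiv i H) = hasseD v (j + 1) H * (j + 1) := by
  rw [hasseD_def, ← derivative_dirShift, Polynomial.coeff_derivative, hasseD_def]

end ChainRule

/-! ## A vanishing polar kills every positive-order Hasse derivative (tame degrees, over a field) -/

section Field

variable {σ : Type*} [Fintype σ] {k : Type*} [Field k]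

/-- **Tame degrees**: if the polar `∂_v H = Σ_i v_i ∂_i H` vanishes and `1, …, deg H` are non-zero in `k` (characteristic
`0`, or `p > deg H`), then `D_v^{(j)} H = 0` for every `j ≥ 1` (for `j ≤ deg H` divide `(j) · D^{(j)} H = D^{(j-1)}(∂_v H)
= 0` by `j`; for `j > deg H` the Hasse derivative vanishes identically). [folklore] -/
theorem hasseD_eq_zero_of_polar_eq_zero (v : σ → k) {H : MvPolynomial σ k}
    (hchar : ∀ m : ℕ, 1 ≤ m → m ≤ H.totalDegree → (m : k) ≠ 0)
    (hpol : ∑ i, C (v i) * pderiv i H = 0) : ∀ j : ℕ, 1 ≤ j → hasseD v j H = 0 := by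
  intro j hj
  rcases Nat.lt_or_ge H.totalDegree j with hlt | hle
  · exact hasseD_eq_zero_of_totalDegree_lt v H hlt
  · obtain ⟨j', rfl⟩ : ∃ j', j = j' + 1 := ⟨j - 1, by omega⟩
    have h := hasseD_polar v j' H
    rw [hpol, hasseD_zero_right] at h
    have hne : ((j' : MvPolynomial σ k) + 1) ≠ 0 := by
      rw [← Nat.cast_succ, ← map_natCast (C : k →+* MvPolynomial σ k), Ne, C_eq_zero]
      exact hchar (j' + 1) (by omega) hle
    exact (mul_eq_zero.mp h.symm).resolve_right hne

/-- The hypothesis «`1, …, N` non-zero in `k`» in characteristic `p > N`. [folklore] -/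
theorem natCast_ne_zero_of_lt_char (p : ℕ) [CharP k p] {N : ℕ} (hN : N < p) :
    ∀ m : ℕ, 1 ≤ m → m ≤ N → (m : k) ≠ 0 := by
  intro m h1 hm
  rw [Ne, CharP.cast_eq_zero_iff k p m]
  exact fun hdvd => absurd (Nat.le_of_dvd (by omega) hdvd) (by omega)

/-- The hypothesis «`1, …, N` non-zero in `k`» in characteristic `0`. [folklore] -/
theorem natCast_ne_zero_of_charZero [CharZero k] (N : ℕ) :
    ∀ m : ℕ, 1 ≤ m → m ≤ N → (m : k) ≠ 0 := by
  intro m h1 _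
  exact Nat.cast_ne_zero.mpr (by omega)

end Field

/-! ## The tame directrix is first-order: `𝕎({F}) = ker (w ↦ ∂_w F)` and `τ({F}) = dim ⟨∂_i F⟩` -/

section Directrix

universe u

variable (k : Type u) [Field k] {d : ℕ}

/-- **Tame degrees: a vanishing polar gives translation invariance.** If `Σ_i w_i ∂F/∂Y_i = 0` and `1, …, deg F` are
non-zero in `k`, then `F(Y + Tw) = F(Y)`, i.e. `w ∈ 𝕎({F})` (all positive-order Hasse derivatives along `w` vanish,
and `𝕎` is read through them by the tree's `mem_invarianceSpace_iff_hasseD`). The converse holds in every characteristic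
(`sum_C_mul_pderiv_eq_zero_of_mem_invarianceSpace`). [folklore] -/
theorem mem_invarianceSpace_singleton_of_polar_eq_zero {F : MvPolynomial (Fin d) k}
    (hchar : ∀ m : ℕ, 1 ≤ m → m ≤ F.totalDegree → (m : k) ≠ 0) {w : Fin d → k}
    (hw : ∑ i, C (w i) * pderiv i F = 0) :
    w ∈ invarianceSpace k ({F} : Set (MvPolynomial (Fin d) k)) := by
  rw [mem_invarianceSpace_iff_hasseD]
  intro G hG j hj
  rw [Set.mem_singleton_iff] at hG
  subst hG
  exact hasseD_eq_zero_of_polar_eq_zero w hchar hw j hj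

/-- [OURS · L1 W4.6 (iv); NOT a statement of the manuscript] **The tame directrix is first-order.** For a polynomial
`F ∈ k[Y_1, …, Y_d]` with `1, …, deg F` non-zero in `k` (characteristic `0`, or `p > deg F`), Hironaka's invariance
space is the kernel of the polar map: `𝕎({F}) = {w | Σ_i w_i ∂F/∂Y_i = 0}`. This is the equality left open in the
tree's `HironakaDirectrixPolar` («with equality when `char k = 0` or `char k > deg F`, not proved here»); it FAILS at
`deg F = p` (`invarianceSpace_X_pow_char_ne_ker_polar`). [folklore] -/
theorem invarianceSpace_singleton_eq_ker_polar (F : MvPolynomial (Fin d) k)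
    (hchar : ∀ m : ℕ, 1 ≤ m → m ≤ F.totalDegree → (m : k) ≠ 0) :
    invarianceSpace k ({F} : Set (MvPolynomial (Fin d) k)) =
      LinearMap.ker (Fintype.linearCombination k fun i : Fin d => pderiv i F) := by
  refine le_antisymm (invarianceSpace_le_ker_polar k F) fun w hw => ?_
  rw [LinearMap.mem_ker, Fintype.linearCombination_apply] at hw
  refine mem_invarianceSpace_singleton_of_polar_eq_zero k hchar ?_
  simpa [MvPolynomial.smul_eq_C_mul] using hw

/-- [OURS · L1 W4.6 (iv); NOT a statement of the manuscript] **`τ({F}) = dim_k ⟨∂F/∂Y_1, …, ∂F/∂Y_d⟩` in the tame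
degrees** (`1, …, deg F` non-zero in `k`): equality in the tree's polar bound `finrank_span_pderiv_le_hironakaTau`, by
rank–nullity and `τ + dim 𝕎 = d`. [folklore] -/
theorem hironakaTau_singleton_eq_finrank_span_pderiv (F : MvPolynomial (Fin d) k)
    (hchar : ∀ m : ℕ, 1 ≤ m → m ≤ F.totalDegree → (m : k) ≠ 0) :
    hironakaTau k ({F} : Set (MvPolynomial (Fin d) k)) =
      Module.finrank k (Submodule.span k (Set.range fun i : Fin d => pderiv i F)) := by
  set f := Fintype.linearCombination k fun i : Fin d => pderiv i F with hf
  have hrange : LinearMap.range f = Submodule.span k (Set.range fun i : Fin d => pderiv i F) :=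
    Fintype.range_linearCombination k _
  have hrn := LinearMap.finrank_range_add_finrank_ker f
  rw [Module.finrank_fin_fun] at hrn
  have hker : Module.finrank k (invarianceSpace k ({F} : Set (MvPolynomial (Fin d) k))) =
      Module.finrank k (LinearMap.ker f) := by
    rw [invarianceSpace_singleton_eq_ker_polar k F hchar]
  have hτ := hironakaTau_add_finrank_invarianceSpace k ({F} : Set (MvPolynomial (Fin d) k))
  rw [← hrange]
  omega

/-- [OURS · L1 W4.6 (iv)] The same for a SET of polynomials, each of tame degree: `𝕎(S) = ⋂_{F ∈ S} ker (w ↦ ∂_w F)`.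
[folklore] -/
theorem invarianceSpace_eq_iInf_ker_polar (S : Set (MvPolynomial (Fin d) k))
    (hchar : ∀ F ∈ S, ∀ m : ℕ, 1 ≤ m → m ≤ F.totalDegree → (m : k) ≠ 0) :
    invarianceSpace k S = ⨅ F ∈ S, LinearMap.ker (Fintype.linearCombination k fun i : Fin d => pderiv i F) := by
  apply le_antisymm
  · intro w hw
    simp only [Submodule.mem_iInf]
    intro F hF
    exact invarianceSpace_le_ker_polar k F (invarianceSpace_antitone k (Set.singleton_subset_iff.mpr hF) hw)
  · intro w hw
    simp only [Submodule.mem_iInf] at hw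
    rw [mem_invarianceSpace_iff]
    intro F hF
    have hpol : ∑ i, C (w i) * pderiv i F = 0 := by
      have h := hw F hF
      rw [LinearMap.mem_ker, Fintype.linearCombination_apply] at h
      simpa [MvPolynomial.smul_eq_C_mul] using h
    exact (mem_invarianceSpace_iff k).1 (mem_invarianceSpace_singleton_of_polar_eq_zero k (hchar F hF) hpol) F rfl

/-- [OURS · L1 W4.6 (iv)] **Characteristic `p > deg F`**: `𝕎({F}) = ker (w ↦ ∂_w F)`. [folklore] -/
theorem invarianceSpace_singleton_eq_ker_polar_of_totalDegree_lt_char (p : ℕ) [CharP k p]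
    (F : MvPolynomial (Fin d) k) (hF : F.totalDegree < p) :
    invarianceSpace k ({F} : Set (MvPolynomial (Fin d) k)) =
      LinearMap.ker (Fintype.linearCombination k fun i : Fin d => pderiv i F) :=
  invarianceSpace_singleton_eq_ker_polar k F (natCast_ne_zero_of_lt_char p hF)

/-- [OURS · L1 W4.6 (iv)] **Characteristic `p > deg F`**: `τ({F}) = dim_k ⟨∂F/∂Y_i⟩` — the directrix of a tangent
form of degree `b < p` is computed by first-order calculus («`C = b`»). [folklore] -/
theorem hironakaTau_singleton_eq_finrank_span_pderiv_of_totalDegree_lt_char (p : ℕ) [CharP k p]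
    (F : MvPolynomial (Fin d) k) (hF : F.totalDegree < p) :
    hironakaTau k ({F} : Set (MvPolynomial (Fin d) k)) =
      Module.finrank k (Submodule.span k (Set.range fun i : Fin d => pderiv i F)) :=
  hironakaTau_singleton_eq_finrank_span_pderiv k F (natCast_ne_zero_of_lt_char p hF)

/-- [OURS · L1 W4.6 (iv)] **Characteristic `0`**: `τ({F}) = dim_k ⟨∂F/∂Y_i⟩` for every `F`. [folklore] -/
theorem hironakaTau_singleton_eq_finrank_span_pderiv_of_charZero [CharZero k] (F : MvPolynomial (Fin d) k) :
    hironakaTau k ({F} : Set (MvPolynomial (Fin d) k)) =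
      Module.finrank k (Submodule.span k (Set.range fun i : Fin d => pderiv i F)) :=
  hironakaTau_singleton_eq_finrank_span_pderiv k F (natCast_ne_zero_of_charZero F.totalDegree)

/-! ### Giraud's lemma in the tame case: the directrix of a form is cut out by its `(b−1)`-st partials -/

/-- Iterated partials of `0` vanish. [folklore] -/
theorem foldr_pderiv_zero {σ : Type*} {R : Type*} [CommSemiring R] (l : List σ) :
    l.foldr (fun i G => pderiv i G) (0 : MvPolynomial σ R) = 0 := by
  induction l with
  | nil => rfl
  | cons i l ih => simp only [List.foldr_cons, ih, map_zero]

/-- [OURS · L1 W4.6 (iv); NOT a statement of the manuscript] **Tame Giraud lemma.** For a FORM `F` of degree `b` with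
`1, …, b` non-zero in `k` (characteristic `0` or `p > b`), a vector `w` leaves `F` translation invariant iff every
linear form `∂_{i_1} ⋯ ∂_{i_{b−1}} F` vanishes at `w` (its derivative along `w` is zero): Hironaka's directrix of a tame
form is cut out by its `(b−1)`-st partial derivatives — the linear Hasse–Schmidt derivatives up to the invertible
factors `A!` (Berthomieu–Hivert–Mourtada, Lemma 3.6 / Algorithm 3.5, there for characteristic `0`). Combines
`invarianceSpace_singleton_eq_ker_polar` with the seat's `TameDirectrix.dirDeriv_eq_zero_of_partials` (p477862).
[folklore] -/
theorem mem_invarianceSpace_singleton_iff_top_polars {F : MvPolynomial (Fin d) k} {b : ℕ}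
    (hF : F.IsHomogeneous b) (hchar : ∀ m : ℕ, 1 ≤ m → m ≤ b → (m : k) ≠ 0) {w : Fin d → k} :
    w ∈ invarianceSpace k ({F} : Set (MvPolynomial (Fin d) k)) ↔
      ∀ l : List (Fin d), l.length = b - 1 →
        ∑ i, C (w i) * pderiv i (l.foldr (fun i G => pderiv i G) F) = 0 := by
  have hchar' : ∀ m : ℕ, 1 ≤ m → m ≤ F.totalDegree → (m : k) ≠ 0 :=
    fun m h1 hm => hchar m h1 (hm.trans hF.totalDegree_le)
  constructor
  · intro hw l _
    have hpol := sum_C_mul_pderiv_eq_zero_of_mem_invarianceSpace k hw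
    rw [← TameDirectrix.foldr_pderiv_dirDeriv, hpol, foldr_pderiv_zero]
  · intro hw
    refine mem_invarianceSpace_singleton_of_polar_eq_zero k hchar' ?_
    exact TameDirectrix.dirDeriv_eq_zero_of_partials hF (fun m hm hmb => hchar m hm hmb.le) w hw

end Directrix

/-! ## Sharpness at `deg F = p`: the form `Y_0^p` -/

section Sharp

universe u

variable (k : Type u) [Field k] (p : ℕ) [Fact p.Prime] [CharP k p] {d : ℕ}

omit [Fact p.Prime] in
/-- In characteristic `p` every partial derivative of `Y_0^p ∈ k[Y_0, …, Y_d]` vanishes. [folklore] -/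
theorem pderiv_X_zero_pow_char (i : Fin (d + 1)) :
    pderiv i ((X 0 : MvPolynomial (Fin (d + 1)) k) ^ p) = 0 := by
  rw [pderiv_pow, CharP.cast_eq_zero (MvPolynomial (Fin (d + 1)) k) p, zero_mul, zero_mul]

omit [Fact p.Prime] in
/-- … so the polar map of `Y_0^p` is zero: its kernel is everything. [folklore] -/
theorem ker_polar_X_pow_char_eq_top :
    LinearMap.ker (Fintype.linearCombination k fun i : Fin (d + 1) =>
      pderiv i ((X 0 : MvPolynomial (Fin (d + 1)) k) ^ p)) = ⊤ := by
  rw [eq_top_iff]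
  intro w _
  rw [LinearMap.mem_ker, Fintype.linearCombination_apply]
  simp [pderiv_X_zero_pow_char k p]

omit [Fact p.Prime] in
/-- … and the polar rank of `Y_0^p` is `0`. [folklore] -/
theorem finrank_span_pderiv_X_pow_char :
    Module.finrank k (Submodule.span k (Set.range fun i : Fin (d + 1) =>
      pderiv i ((X 0 : MvPolynomial (Fin (d + 1)) k) ^ p))) = 0 := by
  have h : (Set.range fun i : Fin (d + 1) => pderiv i ((X 0 : MvPolynomial (Fin (d + 1)) k) ^ p)) ⊆ {0} := by
    rintro _ ⟨i, rfl⟩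
    exact pderiv_X_zero_pow_char k p i
  have h0 : Submodule.span k (Set.range fun i : Fin (d + 1) =>
      pderiv i ((X 0 : MvPolynomial (Fin (d + 1)) k) ^ p)) = ⊥ :=
    Submodule.span_eq_bot.mpr fun x hx => h hx
  rw [h0, finrank_bot]

omit [CharP k p] in
/-- **But `e_0 ∉ 𝕎({Y_0^p})`**: `(Y_0 + T)^p = Y_0^p + T^p ≠ Y_0^p` — the top Hasse derivative `D_{e_0}^{(p)} Y_0^p = 1`
does not vanish. [folklore] -/
theorem single_notMem_invarianceSpace_X_pow_char :
    (Pi.single 0 1 : Fin (d + 1) → k) ∉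
      invarianceSpace k ({(X 0 : MvPolynomial (Fin (d + 1)) k) ^ p} : Set (MvPolynomial (Fin (d + 1)) k)) := by
  have hp : p.Prime := Fact.out
  rw [mem_invarianceSpace_iff_hasseD]
  intro h
  have h1 := h _ rfl p hp.one_lt.le
  rw [hasseD_X_pow] at h1
  simp [Nat.choose_self] at h1

/-- [OURS · L1 W4.6 (iv)] **Sharpness of `deg F < p`.** For `F = Y_0^p` in characteristic `p` the invariance space is
NOT the polar kernel (which is all of `k^{d+1}`). [folklore] -/
theorem invarianceSpace_X_pow_char_ne_ker_polar :
    invarianceSpace k ({(X 0 : MvPolynomial (Fin (d + 1)) k) ^ p} : Set (MvPolynomial (Fin (d + 1)) k)) ≠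
      LinearMap.ker (Fintype.linearCombination k fun i : Fin (d + 1) =>
        pderiv i ((X 0 : MvPolynomial (Fin (d + 1)) k) ^ p)) := by
  rw [ker_polar_X_pow_char_eq_top k p]
  intro h
  exact single_notMem_invarianceSpace_X_pow_char k p (d := d) (h ▸ Submodule.mem_top)

omit [CharP k p] in
/-- [OURS · L1 W4.6 (iv)] `τ(Y_0^p) = 1` in every characteristic (the form is non-constant and involves one variable),
whereas in characteristic `p` its polar rank is `0` (`finrank_span_pderiv_X_pow_char`): the tame equality
`τ = dim ⟨∂_i F⟩` fails exactly when the degree reaches `p`. [folklore] -/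
theorem hironakaTau_X_pow_char :
    hironakaTau k ({(X 0 : MvPolynomial (Fin (d + 1)) k) ^ p} : Set (MvPolynomial (Fin (d + 1)) k)) = 1 := by
  have hp : p.Prime := Fact.out
  apply le_antisymm
  · refine (hironakaTau_le_card_vars k _).trans ?_
    calc ((X 0 : MvPolynomial (Fin (d + 1)) k) ^ p).vars.card ≤ ({0} : Finset (Fin (d + 1))).card :=
          Finset.card_le_card ((vars_pow _ _).trans (by rw [vars_X]))
      _ = 1 := Finset.card_singleton _
  · exact one_le_hironakaTau k (Set.mem_singleton _) hp.one_lt.le (isHomogeneous_X_pow _ _)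
      (pow_ne_zero _ (X_ne_zero _))

/-- [OURS · L1 W4.6 (iv)] In characteristic `p`, `τ(Y_0^p) ≠ dim ⟨∂_i Y_0^p⟩` (`1 ≠ 0`). [folklore] -/
theorem hironakaTau_X_pow_char_ne_finrank_span_pderiv :
    hironakaTau k ({(X 0 : MvPolynomial (Fin (d + 1)) k) ^ p} : Set (MvPolynomial (Fin (d + 1)) k)) ≠
      Module.finrank k (Submodule.span k (Set.range fun i : Fin (d + 1) =>
        pderiv i ((X 0 : MvPolynomial (Fin (d + 1)) k) ^ p))) := by
  rw [hironakaTau_X_pow_char k p, finrank_span_pderiv_X_pow_char k p]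
  exact one_ne_zero

end Sharp

end TamePolar
end CampaignW46
end Summit.ResolutionOfSingularities.ResolutionOfSingularities.Theorems

end
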